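import Summits.QuantumFields.BalabanUV.T4Continuum.Support.NE7PinnedLandauLettersOfLHCI
import Summits.QuantumFields.BalabanUV.T4Continuum.Support.NE7PointedSupRegularity
import Summits.QuantumFields.BalabanUV.T4Continuum.Spine.NE3.LandauProjectionSupCurvedUniform
import Summits.QuantumFields.BalabanUV.T4Continuum.Spine.NE3.SupRegularityCurvedUniform
import HarnessLib

/-!
# NE7PinnedLandauRepB8 — «REP WITH A FIXED TOP» DOCKED: the PINNED, (1.38)-LANDAU representative `U^u = We^{Z}` (`u(M•z) = 1`, `Z` Landau against B8's class
# `N(Q′(W))`) with E′'s radii EXISTS at every `W` of row NE3's class, MODULO ONE OBJECT — the Landau-harmonic corner interpolation (LHCI) of `W` (existence with the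
# Laplacian bound `C_I∕M²`, and uniqueness); every other letter is a tree theorem (F83, row NE3's E′ letters, §1); file 25

Cell `pub-balaban`, rung (B)+1 sub-cell t4, lineage `b2b-balaban-t4-ne7-p1` (CRUX PROVER NE7 #1 = OWNER of row NE7), generation 77; memo
`t4/b2b-balaban-t4-ne7-p1-g77/GAUGED-TOP-TT.md` §5∕§8.  File F91 (over F89 `NE7PinnedLandauRepT.exists_pinnedLandauRep_W_T_of_supFacts` with `T := (· ∈ avgKernelGauges)`,
F90 `NE7PinnedLandauLettersOfLHCI` (hProj∕hR from Galerkin + LHCI), F83 `NE7PointedSupRegularity.supRegularity_pointed` ((H0_W) on pointed generators), and row NE3's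
`LandauProjectionB8.exists_landauB8_correction` ∕ `eq_zero_of_covLapSite_eq_zero`, `LandauProjectionSupCurvedUniform.hRW_of_radii`, `SupRegularityCurvedUniform.supRegularity_uniform`).
WHY (memo §3–§5, §8).  The curved (APE) needs a representative over `W`'s datum whose gauge is PINNED at the top corners (then `cavgIter (U^u) = cavgIter U = cavgIter W`,
F74, and F76∕F78 apply with `ω = 0`) and which is EXACTLY Landau (for (L1)'s quantifier).  Gen 76's pointed-TEST version died at its sup letter (memo §1); gen 77's
analysis (memo §3–§5) located the Petrov–Galerkin structure — pointed TRIAL, smeared TEST — and F87–F90 reduced everything to the Galerkin letters of the test class plus the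
LHCI.  THIS FILE takes the test class to be B8's `N(Q′(W))` ITSELF, for which ALL Galerkin letters are tree theorems (row NE3's E′), supplies the one missing Galerkin
piece (§1: the projection in the `Δ` form, for SITE fields — the tree's is in the `gaugeDir` form for bond fields), and docks: the pinned B8-Landau representative ⇐ LHCI_{B8}.
CAVEAT (memo §4∕§7, flat numerics j276031∕j276098∕j276448): for B8's CORNERED blocks the LHCI constant `C_I` is M-uniform for ODD `N` and DEGENERATE for EVEN `N`; the dual
(corner-centred) class is M-uniform for all `N` — its docking needs the translates of row NE3's letters (not here).
WHAT ([folklore]; 0 def, 0 sorry).  §1 **`exists_galerkinB8_site`** — for a skew periodic SITE field `F`: `∃ λ ∈ N(Q′(W))` with `Σ hsR (F + Δ_Wλ)(Δ_Wν) = 0` ∀`ν ∈ N(Q′(W))`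
(Riesz vector of `ν ↦ −Σ hsR F (Δν)` for the Gram form `Σ hsR (Δλ)(Δν)`, nondegenerate by `eq_zero_of_covLapSite_eq_zero`).
§2 **`exists_pinnedLandauRepB8_of_lhci`** — the pinned (1.38)-Landau representative with radii `r̄ = r₀ + (5∕2)c₁Mc_Rb₀`, `‖Z‖ ≤ 2r̄`, `‖u − 1‖ ≤ 4c₀M²c_Rb₀`,
`‖covDiv_W Z‖ ≤ b₀ + 3c_Rb₀`, where `c₁ = 36d²`, `c₀ = 36d³` (F83) and `c_R = c_R^{E′}·(1 + C_I·36d(frameC + d)²)`, MODULO the LHCI of `W` by shape (`hI`, `hIu`).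
HONEST FRAMING (page 1): docking of tree theorems; the LHCI (`hI`, `hIu`) is a HYPOTHESIS (flat numerics only; degenerate for even `N` in this cornered class); nothing of
Bałaban's asserted; (APE) NOT proved; NOT ONE-STEP, NOT NE7; spine 0∕9; finite T⁴ rung (B)+1 — NOT infinite volume, NOT mass gap, NOT `BetaPertH`, NOT Clay.  Continuum YM on
T⁴ ⇐ BetaPertH ∧ nine spine estimates (0/9 proved); BetaPertH ⇐ (D1) ∧ (D4) ∧ CAP+tail; G-an2-4 gates asym, D1 and NE2/3/4.
-/

set_option autoImplicit false

open NormedSpace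
open scoped BigOperators Matrix.Norms.L2Operator
open Finset

namespace Summit.QuantumFields.BalabanUV.T4Continuum.NE7PinnedLandauRepB8

open Literature.MathematicalPhysics.QuantumFieldTheory.Balaban1983to89
open B7Prop1Explicit B7Prop2Explicit MatrixLog MatrixNorms
open T4AveragingDeficitWall (Ad IsUnitaryCfg IsSkewDir SmallField vary)
open T4AveragingDeficitWallBoundary (IsPeriodicCfg periodBox)
open AveragingDeficitPeriodicCounting (IsPeriodicDir)
open AveragingDeficitMultiLevelPrep (LevelSmall)
open NE3EnergyShapes (IsUnitarySite IsPeriodicSite)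
open NE3CovariantWeitzenbock (covDiv)
open NE3CovariantCalculus (hsR hsR_add_left hsR_add_right hsR_self)
open NE3LandauOrbit (eq_zero_of_nhsNormSq_eq_zero)
open NE3FrameFreeSliceW (bmeanIterW_add bmeanIterW_smul bmeanIterW_zero')
open NE3FrameFreeDecompositionPrep (hsR_smul_left hsR_smul_right)
open NE3RightInverseSupLetters (frameC)
open BlockAveragePushDirGauge (gaugeDir)
open NE3.PairLandauB8 (covLapSite avgKernelGauges mem_avgKernelGauges_iff IsLandauB8)
open NE3.LandauProjectionB8 (covLapSite_add covLapSite_smul exists_landauB8_correction eq_zero_of_covLapSite_eq_zero)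
open NE3.LandauProjectionSupCurvedUniform (hRW_of_radii)
open NE3.SupRegularityCurvedUniform (supRegularity_uniform)
open PeriodicChoice (apply_wrap_eq wrap_mem_periodBox)
open NE7PointedSupRegularity (supRegularity_pointed)
open NE7PinnedLandauRepT (exists_pinnedLandauRep_W_T_of_supFacts)
open NE7PinnedLandauLettersOfLHCI (pinnedProj_of_galerkin_lhci pinnedSupLetter_of_galerkin_lhci)

noncomputable section

variable {d : ℕ} {n : Type*} [Fintype n] [DecidableEq n]

/-! ## §1 The Galerkin projection of B8's class in the `Δ` form, for site fields -/

/-- **THE GALERKIN PROJECTION OF `N(Q′(W))` IN THE `Δ` FORM**: for every site field `F` there is `λ ∈ avgKernelGauges L N (j+1) W` with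
`Σ_y hsR (F y + Δ_Wλ y) (Δ_Wν y) = 0` for all `ν ∈ avgKernelGauges L N (j+1) W` — the Riesz vector of `ν ↦ −Σ hsR F (Δ_Wν)` for the Gram form `Σ hsR (Δ_Wλ)(Δ_Wν)`,
nondegenerate by `eq_zero_of_covLapSite_eq_zero` (twin of `exists_landauB8_correction`, whose datum is a bond field). [folklore] -/
theorem exists_galerkinB8_site [Nonempty n] {L N : ℕ} (hL : 1 ≤ L) (hN : 1 ≤ N) (j : ℕ) {W : Site d → Fin d → (Matrix n n ℂ)ˣ} {x : ℝ}
    (hWu : IsUnitaryCfg W) (hWP : IsPeriodicCfg W ((N * L ^ (j + 1) : ℕ) : ℤ)) (hx : 0 ≤ x) (hs : LevelSmall d L j x) (hWx : SmallField W x)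
    (F : Site d → Matrix n n ℂ) :
    ∃ lam ∈ avgKernelGauges (d := d) (n := n) L N (j + 1) W,
      ∀ nu ∈ avgKernelGauges (d := d) (n := n) L N (j + 1) W,
        ∑ y ∈ periodBox (d := d) (N * L ^ (j + 1)), hsR (F y + covLapSite W lam y) (covLapSite W nu y) = 0 := by
  haveI : NeZero N := ⟨by omega⟩
  have hP : 1 ≤ N * L ^ (j + 1) := Nat.mul_pos (by omega) (Nat.pow_pos (by omega))
  -- `N(Q′(W))` as a real submodule
  let S : Submodule ℝ (Site d → Matrix n n ℂ) :=
    { carrier := avgKernelGauges (d := d) (n := n) L N (j + 1) W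
      zero_mem' := ⟨fun _ => (skewAdjoint _).zero_mem, fun _ _ => rfl, bmeanIterW_zero' L (j + 1) W⟩
      add_mem' := by
        rintro mu nu ⟨hμs, hμP, hμ0⟩ ⟨hνs, hνP, hν0⟩
        refine ⟨fun y => (skewAdjoint _).add_mem (hμs y) (hνs y), fun y i => ?_, ?_⟩
        · simp only [Pi.add_apply, hμP, hνP]
        · rw [bmeanIterW_add, hμ0, hν0, add_zero]
      smul_mem' := by
        rintro t mu ⟨hμs, hμP, hμ0⟩
        refine ⟨fun y => skewAdjoint.smul_mem t (hμs y), fun y i => ?_, ?_⟩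
        · simp only [Pi.smul_apply, hμP]
        · rw [bmeanIterW_smul, hμ0, smul_zero] }
  have hSmem : ∀ {mu : Site d → Matrix n n ℂ}, mu ∈ S ↔ mu ∈ avgKernelGauges (d := d) (n := n) L N (j + 1) W := fun {mu} => Iff.rfl
  -- finite-dimensional: restriction to the period box is injective
  haveI : FiniteDimensional ℝ S := by
    let res : S →ₗ[ℝ] (↥(periodBox (d := d) (N * L ^ (j + 1))) → Matrix n n ℂ) :=
      { toFun := fun ξ y => (ξ : Site d → Matrix n n ℂ) y.1
        map_add' := fun _ _ => rfl
        map_smul' := fun _ _ => rfl }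
    refine FiniteDimensional.of_injective res fun ξ ζ h => ?_
    apply Subtype.ext
    funext y
    have hξ := apply_wrap_eq (mem_avgKernelGauges_iff.mp (hSmem.mp ξ.2)).2.1 y
    have hζ := apply_wrap_eq (mem_avgKernelGauges_iff.mp (hSmem.mp ζ.2)).2.1 y
    rw [← hξ, ← hζ]
    exact congr_fun h ⟨_, wrap_mem_periodBox (N * L ^ (j + 1)) hP y⟩
  -- the Gram form of `Δ_W` on the class
  let G : LinearMap.BilinForm ℝ S :=
    LinearMap.mk₂ ℝ
      (fun lam nu => ∑ y ∈ periodBox (d := d) (N * L ^ (j + 1)),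
        hsR (covLapSite W (lam : Site d → Matrix n n ℂ) y) (covLapSite W (nu : Site d → Matrix n n ℂ) y))
      (fun lam lam' nu => by
        simp only [Submodule.coe_add, covLapSite_add, Pi.add_apply, hsR_add_left, Finset.sum_add_distrib])
      (fun t lam nu => by
        simp only [Submodule.coe_smul, covLapSite_smul, Pi.smul_apply, hsR_smul_left, Finset.mul_sum, smul_eq_mul])
      (fun lam nu nu' => by
        simp only [Submodule.coe_add, covLapSite_add, Pi.add_apply, hsR_add_right, Finset.sum_add_distrib])
      (fun t lam nu => by
        simp only [Submodule.coe_smul, covLapSite_smul, Pi.smul_apply, hsR_smul_right, Finset.mul_sum, smul_eq_mul])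
  have hG : ∀ lam nu : S, G lam nu = ∑ y ∈ periodBox (d := d) (N * L ^ (j + 1)),
      hsR (covLapSite W (lam : Site d → Matrix n n ℂ) y) (covLapSite W (nu : Site d → Matrix n n ℂ) y) := fun _ _ => rfl
  -- nondegeneracy: `G λ λ = Σ‖Δλ‖²`
  have key : ∀ lam : S, G lam lam = 0 → lam = 0 := by
    intro lam h
    rw [hG] at h
    simp only [hsR_self] at h
    have hbox : ∀ y ∈ periodBox (d := d) (N * L ^ (j + 1)), covLapSite W (lam : Site d → Matrix n n ℂ) y = 0 := by
      intro y hy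
      have h1 := (Finset.sum_eq_zero_iff_of_nonneg fun y' _ => nhsNormSq_nonneg (covLapSite W (lam : Site d → Matrix n n ℂ) y')).1 h y hy
      exact eq_zero_of_nhsNormSq_eq_zero h1
    exact Subtype.ext (eq_zero_of_covLapSite_eq_zero hL hN j hWu hWP hx hs hWx (hSmem.mp lam.2) hbox)
  have hGnd : G.Nondegenerate := ⟨fun lam hlam => key lam (hlam lam), fun lam hlam => key lam (hlam lam)⟩
  -- the functional and its Riesz vector
  let ℓ : Module.Dual ℝ S :=
    { toFun := fun nu => -∑ y ∈ periodBox (d := d) (N * L ^ (j + 1)), hsR (F y) (covLapSite W (nu : Site d → Matrix n n ℂ) y)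
      map_add' := fun nu nu' => by
        simp only [Submodule.coe_add, covLapSite_add, Pi.add_apply, hsR_add_right, Finset.sum_add_distrib, neg_add]
      map_smul' := fun t nu => by
        simp only [Submodule.coe_smul, covLapSite_smul, Pi.smul_apply, hsR_smul_right, Finset.mul_sum, RingHom.id_apply,
          smul_eq_mul, mul_neg] }
  set lam := (G.toDual hGnd).symm ℓ with hlam_def
  refine ⟨lam, hSmem.mp lam.2, fun nu hnu => ?_⟩
  have h := LinearMap.BilinForm.apply_toDual_symm_apply (hB := hGnd) ℓ ⟨nu, hnu⟩
  rw [← hlam_def, hG] at h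
  have hℓ : ℓ ⟨nu, hnu⟩ = -∑ y ∈ periodBox (d := d) (N * L ^ (j + 1)), hsR (F y) (covLapSite W nu y) := rfl
  rw [hℓ] at h
  simp only [hsR_add_left, Finset.sum_add_distrib]
  linarith

/-! ## §2 THE PINNED B8-LANDAU REPRESENTATIVE, MODULO THE LHCI -/

/-- **«REP WITH A FIXED TOP», DOCKED MODULO THE LHCI OF `W`.**  `W` of row NE3's class (unitary, `(N·L^{j+1})`-periodic, plaquette radius `x`, plaquette-gradient
radius `x₁`, E′'s radius lines `hbx`, `hcx`); the LHCI of `W` by shape: `hI` (for every skew `N`-periodic corner datum `a` a skew periodic `η` with `η(M•w) = a(w)`,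
`gaugeDir_W η` (1.38)-Landau, `‖Δ_Wη‖ ≤ (C_I∕M²)·sup‖a‖`) and `hIu` (a pointed skew periodic generator whose Laplacian is (1.38)-Landau-harmonic has zero Laplacian);
`U` unitary periodic with the initial (−1)∕(−2) gauge `r₀`, `b₀` relative to `W` and the four regime lines of E′ at the constants `c₁ = 36d²`, `c₀ = 36d³`,
`c_R = c_R^{E′}(1 + C_I·36d(frameC+d)²)`.  THEN the pinned representative exists: `u` unitary periodic with `u(M•z) = 1`, `Z` skew periodic (1.38)-Landau, `U^u = We^{Z}`,
with E′'s radii. [folklore] -/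
theorem exists_pinnedLandauRepB8_of_lhci [Nonempty n] (hd : 1 ≤ d) {L N : ℕ} [NeZero N] (hL : 2 ≤ L) (j : ℕ)
    {W : Site d → Fin d → (Matrix n n ℂ)ˣ} {x x₁ : ℝ} (hWu : IsUnitaryCfg W) (hWP : IsPeriodicCfg W ((N * L ^ (j + 1) : ℕ) : ℤ))
    (hx : 0 ≤ x) (hs : LevelSmall d L j x) (hWx : SmallField W x) (hx10 : 0 ≤ x₁)
    (hgrad : ∀ (p : Site d) (μ κ : Fin d), κ ≠ μ →
      ‖Ad (W p μ) ((hol W (p + e μ) (plaqWord κ μ) : (Matrix n n ℂ)ˣ) : Matrix n n ℂ) - ((hol W p (plaqWord κ μ) : (Matrix n n ℂ)ˣ) : Matrix n n ℂ)‖ ≤ x₁)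
    (hbx : 23040 * (d : ℝ) ^ 4 * (frameC d L + d) ^ 2 * ((L : ℝ) ^ (j + 1)) ^ 2 * x ≤ 1)
    (hcx : 11520 * (d : ℝ) ^ 4 * (frameC d L + d) ^ 3 * ((L : ℝ) ^ (j + 1)) ^ 3 * x₁ ≤ 1)
    -- the LHCI of `W` by shape
    {CI : ℝ} (hCI : 0 ≤ CI)
    (hI : ∀ a : Site d → Matrix n n ℂ, (∀ w, a w ∈ skewAdjoint (Matrix n n ℂ)) → (∀ (w : Site d) (i : Fin d), a (w + (N : ℤ) • e i) = a w) →
      ∃ eta : Site d → Matrix n n ℂ,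
        (∀ y, eta y ∈ skewAdjoint (Matrix n n ℂ)) ∧ (∀ (y : Site d) (i : Fin d), eta (y + ((N * L ^ (j + 1) : ℕ) : ℤ) • e i) = eta y) ∧
        (∀ w : Site d, eta ((((L ^ (j + 1) : ℕ) : ℤ)) • w) = a w) ∧
        IsLandauB8 (d := d) L N (j + 1) W (gaugeDir W eta) ∧
        ∀ A : ℝ, (∀ w, ‖a w‖ ≤ A) → ∀ y, ‖covLapSite W eta y‖ ≤ CI / ((L : ℝ) ^ (j + 1)) ^ 2 * A)
    (hIu : ∀ mu : Site d → Matrix n n ℂ, (∀ y, mu y ∈ skewAdjoint (Matrix n n ℂ)) →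
      (∀ (y : Site d) (i : Fin d), mu (y + ((N * L ^ (j + 1) : ℕ) : ℤ) • e i) = mu y) → (∀ w : Site d, mu ((((L ^ (j + 1) : ℕ) : ℤ)) • w) = 0) →
      (∀ nu ∈ avgKernelGauges (d := d) (n := n) L N (j + 1) W,
        ∑ y ∈ periodBox (d := d) (N * L ^ (j + 1)), hsR (covLapSite W mu y) (covLapSite W nu y) = 0) →
      ∀ y, covLapSite W mu y = 0)
    -- the constants (E′'s `c_R`, F83's `c₀`, `c₁`, the PG `c_R`), named
    {c₀ c₁ cR cRE : ℝ} (hc₁ : c₁ = 36 * d * (d : ℝ)) (hc₀ : c₀ = 36 * d * (d : ℝ) ^ 2)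
    (hcRE : cRE = 1 + 2 * (Fintype.card n : ℝ) * (64 * (d : ℝ) ^ 2 * N) ^ d + 27 * (Fintype.card n : ℝ) ^ 3 * (512 : ℝ) ^ d * (N : ℝ) ^ d)
    (hcR : cR = cRE * (1 + CI * (36 * d * (frameC d L + d) ^ 2)))
    -- the field and its initial gauge relative to `W`; E′'s regime at these constants
    {U : Site d → Fin d → (Matrix n n ℂ)ˣ} (hUu : IsUnitaryCfg U) (hUP : IsPeriodicCfg U ((N * L ^ (j + 1) : ℕ) : ℤ))
    {r₀ b₀ : ℝ} (hr₀ : ∀ (y : Site d) (μ : Fin d), ‖(((W y μ)⁻¹ * U y μ : (Matrix n n ℂ)ˣ) : (Matrix n n ℂ)) - 1‖ ≤ r₀)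
    (hb₀ : ∀ x : Site d, ‖covDiv W (fun y μ => mlog (((W y μ)⁻¹ * U y μ : (Matrix n n ℂ)ˣ) : (Matrix n n ℂ))) x‖ ≤ b₀)
    (hreg₁ : c₀ * ((L : ℝ) ^ (j + 1)) ^ 2 * (cR * b₀) ≤ 1 / 10) (hreg₂ : c₁ * (L : ℝ) ^ (j + 1) * (cR * b₀) ≤ 1 / 25)
    (hreg₃ : r₀ + 5 / 2 * (c₁ * (L : ℝ) ^ (j + 1) * (cR * b₀)) ≤ 1 / 20)
    (hline : cR * (4 * (c₀ * ((L : ℝ) ^ (j + 1)) ^ 2) * (b₀ + 4 * (cR * b₀))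
        + 25 * d * (r₀ + 5 / 2 * (c₁ * (L : ℝ) ^ (j + 1) * (cR * b₀))) * (c₁ * (L : ℝ) ^ (j + 1))
        + 14 * d * (c₁ * (L : ℝ) ^ (j + 1)) ^ 2 * (cR * b₀)) ≤ 1 / 2) :
    ∃ (u : Site d → (Matrix n n ℂ)ˣ) (Z : Site d → Fin d → (Matrix n n ℂ)),
      IsUnitarySite u ∧ IsPeriodicSite u ((N * L ^ (j + 1) : ℕ) : ℤ) ∧ IsSkewDir Z ∧ IsPeriodicDir Z ((N * L ^ (j + 1) : ℕ) : ℤ) ∧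
      gaugeAct u U = vary W Z 1 ∧ (∀ w : Site d, u ((((L ^ (j + 1) : ℕ) : ℤ)) • w) = 1) ∧
      IsLandauB8 (d := d) L N (j + 1) W Z ∧
      (∀ (y : Site d) (μ : Fin d), ‖(((W y μ)⁻¹ * gaugeAct u U y μ : (Matrix n n ℂ)ˣ) : (Matrix n n ℂ)) - 1‖ ≤ r₀ + 5 / 2 * (c₁ * (L : ℝ) ^ (j + 1) * (cR * b₀))) ∧
      (∀ (y : Site d) (μ : Fin d), ‖Z y μ‖ ≤ 2 * (r₀ + 5 / 2 * (c₁ * (L : ℝ) ^ (j + 1) * (cR * b₀)))) ∧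
      (∀ y : Site d, ‖((u y : (Matrix n n ℂ)ˣ) : (Matrix n n ℂ)) - 1‖ ≤ 4 * (c₀ * ((L : ℝ) ^ (j + 1)) ^ 2 * (cR * b₀))) ∧
      (∀ x : Site d, ‖covDiv W Z x‖ ≤ b₀ + 3 * (cR * b₀)) := by
  have hL1 : 1 ≤ L := by omega
  have hN : 1 ≤ N := Nat.one_le_iff_ne_zero.mpr (NeZero.ne N)
  have hP : 1 ≤ N * L ^ (j + 1) := Nat.mul_pos (by omega) (Nat.pow_pos (by omega))
  have hd1 : (1 : ℝ) ≤ d := by exact_mod_cast hd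
  have hFC0 : 0 ≤ frameC d L := by unfold frameC; positivity
  have hc₀0 : 0 ≤ c₀ := by rw [hc₀]; positivity
  have hc₁0 : 0 ≤ c₁ := by rw [hc₁]; positivity
  have hcRE1 : 1 ≤ cRE := by
    have h0 : 0 ≤ 2 * (Fintype.card n : ℝ) * (64 * (d : ℝ) ^ 2 * N) ^ d + 27 * (Fintype.card n : ℝ) ^ 3 * (512 : ℝ) ^ d * (N : ℝ) ^ d := by positivity
    rw [hcRE]; linarith
  have hcR1 : 1 ≤ cR := by
    rw [hcR]
    have h1 : (1 : ℝ) ≤ 1 + CI * (36 * d * (frameC d L + d) ^ 2) := by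
      have : 0 ≤ CI * (36 * d * (frameC d L + d) ^ 2) := by positivity
      linarith
    nlinarith
  -- the test class
  set T : (Site d → Matrix n n ℂ) → Prop := fun nu => nu ∈ avgKernelGauges (d := d) (n := n) L N (j + 1) W with hT
  -- F83's radius lines follow from E′'s (`d ≤ frameC + d`)
  have hdF : (d : ℝ) ≤ frameC d L + d := by linarith
  have hbx' : 23040 * (d : ℝ) ^ 4 * (d : ℝ) ^ 2 * ((L : ℝ) ^ (j + 1)) ^ 2 * x ≤ 1 := by
    have h1 : (d : ℝ) ^ 2 ≤ (frameC d L + d) ^ 2 := pow_le_pow_left₀ (by positivity) hdF 2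
    have h2 : 23040 * (d : ℝ) ^ 4 * (d : ℝ) ^ 2 * ((L : ℝ) ^ (j + 1)) ^ 2 * x
        ≤ 23040 * (d : ℝ) ^ 4 * (frameC d L + d) ^ 2 * ((L : ℝ) ^ (j + 1)) ^ 2 * x := by gcongr
    exact h2.trans hbx
  have hcx' : 11520 * (d : ℝ) ^ 4 * (d : ℝ) ^ 3 * ((L : ℝ) ^ (j + 1)) ^ 3 * x₁ ≤ 1 := by
    have h1 : (d : ℝ) ^ 3 ≤ (frameC d L + d) ^ 3 := pow_le_pow_left₀ (by positivity) hdF 3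
    have h2 : 11520 * (d : ℝ) ^ 4 * (d : ℝ) ^ 3 * ((L : ℝ) ^ (j + 1)) ^ 3 * x₁
        ≤ 11520 * (d : ℝ) ^ 4 * (frameC d L + d) ^ 3 * ((L : ℝ) ^ (j + 1)) ^ 3 * x₁ := by gcongr
    exact h2.trans hcx
  -- hG: (H0_W) on pointed generators, F83
  have hG : ∀ mu : Site d → Matrix n n ℂ, ((∀ y, mu y ∈ skewAdjoint (Matrix n n ℂ)) ∧
      (∀ (y : Site d) (i : Fin d), mu (y + ((N * L ^ (j + 1) : ℕ) : ℤ) • e i) = mu y) ∧ (∀ w : Site d, mu ((((L ^ (j + 1) : ℕ) : ℤ)) • w) = 0)) →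
      ∀ B : ℝ, (∀ y : Site d, ‖covLapSite W mu y‖ ≤ B) →
        (∀ y : Site d, ‖mu y‖ ≤ c₀ * ((L : ℝ) ^ (j + 1)) ^ 2 * B) ∧ (∀ (y : Site d) (μ : Fin d), ‖gaugeDir W mu y μ‖ ≤ c₁ * (L : ℝ) ^ (j + 1) * B) := by
    intro mu hmu B hB
    obtain ⟨hD, hS⟩ := supRegularity_pointed hd hL j hWu hWP hx hWx hx10 hgrad hbx' hcx' hmu.2.1 hmu.2.2 hB
    refine ⟨fun y => (hS y).trans (le_of_eq ?_), fun y μ => (hD y μ).trans (le_of_eq ?_)⟩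
    · rw [hc₀]
    · rw [hc₁]
  -- hProj: F90 §2 from the tree's `gaugeDir`-form projection and the LHCI existence
  have hGal : ∀ Y : Site d → Fin d → Matrix n n ℂ, ∃ lam₁ : Site d → Matrix n n ℂ,
      (∀ y, lam₁ y ∈ skewAdjoint (Matrix n n ℂ)) ∧ (∀ (y : Site d) (i : Fin d), lam₁ (y + ((N * L ^ (j + 1) : ℕ) : ℤ) • e i) = lam₁ y) ∧
      (∀ nu : Site d → Matrix n n ℂ, (∀ y, nu y ∈ skewAdjoint (Matrix n n ℂ)) →
          (∀ (y : Site d) (i : Fin d), nu (y + ((N * L ^ (j + 1) : ℕ) : ℤ) • e i) = nu y) → T nu →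
        ∑ y ∈ periodBox (d := d) (N * L ^ (j + 1)), ∑ κ : Fin d, hsR (Y y κ + gaugeDir W lam₁ y κ) (gaugeDir W (covLapSite W nu) y κ) = 0) := by
    intro Y
    obtain ⟨lam₁, hmem, hLan⟩ := exists_landauB8_correction hL1 hN j hWu hWP hx hs hWx Y
    obtain ⟨h1s, h1P, -⟩ := mem_avgKernelGauges_iff.mp hmem
    exact ⟨lam₁, h1s, h1P, fun nu _ _ hnuT => hLan nu hnuT⟩
  have hIex : ∀ a : Site d → Matrix n n ℂ, (∀ w, a w ∈ skewAdjoint (Matrix n n ℂ)) → (∀ (w : Site d) (i : Fin d), a (w + (N : ℤ) • e i) = a w) →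
      ∃ eta : Site d → Matrix n n ℂ,
        (∀ y, eta y ∈ skewAdjoint (Matrix n n ℂ)) ∧ (∀ (y : Site d) (i : Fin d), eta (y + ((N * L ^ (j + 1) : ℕ) : ℤ) • e i) = eta y) ∧
        (∀ w : Site d, eta ((((L ^ (j + 1) : ℕ) : ℤ)) • w) = a w) ∧
        (∀ nu : Site d → Matrix n n ℂ, (∀ y, nu y ∈ skewAdjoint (Matrix n n ℂ)) →
            (∀ (y : Site d) (i : Fin d), nu (y + ((N * L ^ (j + 1) : ℕ) : ℤ) • e i) = nu y) → T nu →
          ∑ y ∈ periodBox (d := d) (N * L ^ (j + 1)), ∑ κ : Fin d, hsR (gaugeDir W eta y κ) (gaugeDir W (covLapSite W nu) y κ) = 0) := by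
    intro a has haP
    obtain ⟨eta, hes, heP, he0, heL, -⟩ := hI a has haP
    exact ⟨eta, hes, heP, he0, fun nu _ _ hnuT => heL nu hnuT⟩
  have hProj := pinnedProj_of_galerkin_lhci (d := d) (n := n) j T hGal hIex
  -- hR: F90 §3 from §1 + E′'s sup letters + the LHCI with its bound and its uniqueness
  have hGalR : ∀ F : Site d → Matrix n n ℂ, (∀ y, F y ∈ skewAdjoint (Matrix n n ℂ)) →
      (∀ (y : Site d) (i : Fin d), F (y + ((N * L ^ (j + 1) : ℕ) : ℤ) • e i) = F y) →
      ∃ lam₁ : Site d → Matrix n n ℂ,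
        (∀ y, lam₁ y ∈ skewAdjoint (Matrix n n ℂ)) ∧ (∀ (y : Site d) (i : Fin d), lam₁ (y + ((N * L ^ (j + 1) : ℕ) : ℤ) • e i) = lam₁ y) ∧
        (∀ nu : Site d → Matrix n n ℂ, (∀ y, nu y ∈ skewAdjoint (Matrix n n ℂ)) →
            (∀ (y : Site d) (i : Fin d), nu (y + ((N * L ^ (j + 1) : ℕ) : ℤ) • e i) = nu y) → T nu →
          ∑ y ∈ periodBox (d := d) (N * L ^ (j + 1)), hsR (F y + covLapSite W lam₁ y) (covLapSite W nu y) = 0) ∧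
        ∀ B : ℝ, (∀ y, ‖F y‖ ≤ B) →
          (∀ y, ‖covLapSite W lam₁ y‖ ≤ cRE * B) ∧ (∀ y, ‖lam₁ y‖ ≤ (36 * d * (frameC d L + d) ^ 2) * ((L : ℝ) ^ (j + 1)) ^ 2 * (cRE * B)) := by
    intro F hFs hFP
    obtain ⟨lam₁, hmem, horth⟩ := exists_galerkinB8_site hL1 hN j hWu hWP hx hs hWx F
    obtain ⟨h1s, h1P, -⟩ := mem_avgKernelGauges_iff.mp hmem
    refine ⟨lam₁, h1s, h1P, fun nu _ _ hnuT => horth nu hnuT, fun B hFB => ?_⟩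
    have hΔ : ∀ y, ‖covLapSite W lam₁ y‖ ≤ cRE * B := by
      intro y
      rw [hcRE]
      exact hRW_of_radii hd hL j hWu hWP hx hs hWx hx10 hgrad hbx hcx F hFs hFP lam₁ hmem horth B hFB y
    refine ⟨hΔ, fun y => ?_⟩
    exact (supRegularity_uniform hd hL j hWu hWP hx hs hWx hx10 hgrad hbx hcx hmem hΔ).2 y
  have hIR : ∀ a : Site d → Matrix n n ℂ, (∀ w, a w ∈ skewAdjoint (Matrix n n ℂ)) → (∀ (w : Site d) (i : Fin d), a (w + (N : ℤ) • e i) = a w) →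
      ∃ eta : Site d → Matrix n n ℂ,
        (∀ y, eta y ∈ skewAdjoint (Matrix n n ℂ)) ∧ (∀ (y : Site d) (i : Fin d), eta (y + ((N * L ^ (j + 1) : ℕ) : ℤ) • e i) = eta y) ∧
        (∀ w : Site d, eta ((((L ^ (j + 1) : ℕ) : ℤ)) • w) = a w) ∧
        (∀ nu : Site d → Matrix n n ℂ, (∀ y, nu y ∈ skewAdjoint (Matrix n n ℂ)) →
            (∀ (y : Site d) (i : Fin d), nu (y + ((N * L ^ (j + 1) : ℕ) : ℤ) • e i) = nu y) → T nu →
          ∑ y ∈ periodBox (d := d) (N * L ^ (j + 1)), ∑ κ : Fin d, hsR (gaugeDir W eta y κ) (gaugeDir W (covLapSite W nu) y κ) = 0) ∧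
        ∀ A : ℝ, (∀ w, ‖a w‖ ≤ A) → ∀ y, ‖covLapSite W eta y‖ ≤ CI / ((L : ℝ) ^ (j + 1)) ^ 2 * A := by
    intro a has haP
    obtain ⟨eta, hes, heP, he0, heL, heB⟩ := hI a has haP
    exact ⟨eta, hes, heP, he0, fun nu _ _ hnuT => heL nu hnuT, heB⟩
  have hUniq : ∀ mu : Site d → Matrix n n ℂ, (∀ y, mu y ∈ skewAdjoint (Matrix n n ℂ)) →
      (∀ (y : Site d) (i : Fin d), mu (y + ((N * L ^ (j + 1) : ℕ) : ℤ) • e i) = mu y) → (∀ w : Site d, mu ((((L ^ (j + 1) : ℕ) : ℤ)) • w) = 0) →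
      (∀ nu : Site d → Matrix n n ℂ, (∀ y, nu y ∈ skewAdjoint (Matrix n n ℂ)) →
          (∀ (y : Site d) (i : Fin d), nu (y + ((N * L ^ (j + 1) : ℕ) : ℤ) • e i) = nu y) → T nu →
        ∑ y ∈ periodBox (d := d) (N * L ^ (j + 1)), hsR (covLapSite W mu y) (covLapSite W nu y) = 0) →
      ∀ y, covLapSite W mu y = 0 := by
    intro mu hmus hmuP hmu0 horth
    refine hIu mu hmus hmuP hmu0 fun nu hnu => ?_
    obtain ⟨hnus, hnuP, -⟩ := mem_avgKernelGauges_iff.mp hnu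
    exact horth nu hnus hnuP hnu
  have hR' := pinnedSupLetter_of_galerkin_lhci (d := d) (n := n) j hP T hWu hWP (c₀ := 36 * d * (frameC d L + d) ^ 2) (cR := cRE) (CI := CI)
    hGalR hIR hUniq
  have hR : ∀ (F : Site d → Matrix n n ℂ), (∀ y : Site d, F y ∈ skewAdjoint (Matrix n n ℂ)) →
      (∀ (y : Site d) (i : Fin d), F (y + ((N * L ^ (j + 1) : ℕ) : ℤ) • e i) = F y) →
      ∀ mu : Site d → Matrix n n ℂ, ((∀ y, mu y ∈ skewAdjoint (Matrix n n ℂ)) ∧ (∀ (y : Site d) (i : Fin d), mu (y + ((N * L ^ (j + 1) : ℕ) : ℤ) • e i) = mu y) ∧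
        (∀ w : Site d, mu ((((L ^ (j + 1) : ℕ) : ℤ)) • w) = 0)) →
        (∀ nu : Site d → Matrix n n ℂ, (∀ y, nu y ∈ skewAdjoint (Matrix n n ℂ)) →
          (∀ (y : Site d) (i : Fin d), nu (y + ((N * L ^ (j + 1) : ℕ) : ℤ) • e i) = nu y) → T nu →
          ∑ y ∈ periodBox (d := d) (N * L ^ (j + 1)), hsR (F y + covLapSite W mu y) (covLapSite W nu y) = 0) →
        ∀ B : ℝ, (∀ y : Site d, ‖F y‖ ≤ B) → ∀ y : Site d, ‖covLapSite W mu y‖ ≤ cR * B := by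
    intro F hFs hFP mu hmu horth B hFB y
    have h := hR' F hFs hFP mu hmu horth B hFB y
    rw [hcR]
    linarith
  -- F89 with `T` = B8's class
  obtain ⟨u, Z, huU, huP, hZs, hZP, hrep, hu0, hLan, hr, hZ, hu1, hdiv⟩ :=
    exists_pinnedLandauRep_W_T_of_supFacts hd hL hN j T hc₀0 hc₁0 hcR1 hWu hWP hG hR hProj hUu hUP hr₀ hb₀ hreg₁ hreg₂ hreg₃ hline
  refine ⟨u, Z, huU, huP, hZs, hZP, hrep, hu0, fun nu hnu => ?_, hr, hZ, hu1, hdiv⟩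
  obtain ⟨hnus, hnuP, -⟩ := mem_avgKernelGauges_iff.mp hnu
  exact hLan nu hnus hnuP hnu

end

end Summit.QuantumFields.BalabanUV.T4Continuum.NE7PinnedLandauRepB8
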